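import Summits.QuantumFields.YangMills.Theorems.BalabanUVNodesN16PinnedLooseMatchSqueeze
import HarnessLib

/-!
# Route «BalabanUVNodes», crux K3⁸ `SpineGivenEndpointR13SepCoPHV` (stmt-QuantumFields-27366), node N16 = NE3: THE (β16) PRODUCER WITH NODE N19′'s COMPLETE N16-LETTER BLOCK —
# module 49's radii rows PLUS the two CLASS-RADIUS rows `16·C0·ε ≤ 3`, `40960·L²·ε ≤ 1`, exported producer-side from the window lemma of record (no estimate)

Cell `pub-ymgap`, seat `pub-ymgap-dag-n16-e` (R134 acceleration seat (a), strategy s2 = BY-NAME KNIT at the record; HUMAN RULING D-0062; chair R424 venue), generation 17,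
module 50 (THEOREMS ONLY, 0 `def`, 0 `sorry`, standard axioms).  `--kind proof --supports stmt-QuantumFields-27366 --as helper` (count-neutral; proves NO registered stub).
`bears_on: R4∕N16 · edges N05 → N16, N07 → N16 · junction N16 → N19′ ∕ N21 (stub 2)`.  Over module 49 `…N16PinnedLooseMatchSqueeze` (p625574: `leafSlotHolderAT_reletter`,
`inEndRegimeH_reletter`, `squeezeLetters_spec`), this seat's window lemma `…N16AtRecord13OfEdges.exists_window_letters_linearLeaf` and closers
`…N16HolderSlotWindow.inEndRegimeH_ofRecord_of_window` ∕ `…N16SlotWindowAllTorus.leafSlotHolderAT_ofRecord_of_window_linear`, dag-n16-w1's file 6 §1 proof SHAPE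
(`…N16H7LooseOfThm1At.exists_letters_inEndRegimeH_leafSlotHolderAT_of_edges_loose`, whose STATEMENT §1 strengthens by two exported conjuncts) and file 9 §2
`…N16H7LooseOfReg910Slot.h7Shape_loose_of_reg910Slot` — CITED BY NAME, none edited.

WHY THIS FILE EXISTS (numbers).  The LIVE consumer's link reading `hlinkTrim` (dag-n19-w3 `…N19RateEdgeHolderD4AtTrimmedLedgerReading` :143–:146, p620894) carries a NINE-conjunct
block on node N16's letters: `R.ne3.g = gradConst 4 c'`, `0 ≤ c'`, `R.ne3.b ≤ t`, `c' ≤ t`, `2^91·L^17·t ≤ 1`, `2^76·L^12·t ≤ R.ne3.ε`, **`16·C0 4·R.ne3.ε ≤ 3`**,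
**`1024·(4+1)·(4+4)·(R.ne3.L)²·R.ne3.ε ≤ 1`**, `4·((ℓ₃ F).ε ∕ B F) ≤ c'`.  Module 49 §5 produces the seven RADII rows; the two CLASS-RADIUS rows are TRUE at the letters of record —
the window lemma exports `ℓ.ε < α`, `α ≤ c2' 4 F.L ∕ 2 = 1∕(40960·L²)`, `α ≤ 1∕10^9`, and `16·C0 4·10^-9 = 16·23142400·10^-9 ≈ 0.37 ≤ 3` — but are NOT exported by file 6 §1 ∕
(9b) ∕ `LeafSlotHolderAT` (which keeps `c.ε < α`, `C0 4·α ≤ 1∕3`, `2α ≤ c2'`: the second row follows, the first does NOT — `16∕3 > 3`).  This file exports them.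

WHAT THIS FILE PROVES (kernel).  §1 `exists_letters_inEndRegimeH_leafSlotHolderAT_classRadius_of_edges_loose` — file 6 §1's per-family statement (letters of record ∧
`InEndRegimeH` ∧ `LeafSlotHolderAT · β` at the loose object of radius `ℓ.ε ∕ B`, from `h5` and a loose linear leaf) PLUS `16·C0 4·ℓ.ε ≤ 3 ∧ 1024·(4+1)·(4+4)·(F.L)²·ℓ.ε ≤ 1`
(file 6 §1's proof shape; two arithmetic lines added).  §2 `…_classRadius_of_h5_reg910Slot` — the same at the SLOT KEY (§1 ∘ `h7Shape_loose_of_reg910Slot`, as (9b)).  §3 ★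
`exists_letters_n16HolderAtReading_loose_squeezeFull_of_h5_reg910Slot` — module 49 §3's producer with the rows conjunct carrying ALL NINE N16-letter rows (+ `0 < c'`,
`ε∕B ≤ 1∕4`); §4 the K3-stub-1 shape `∃ ℓ₃ g B c'`; §5 `n16LetterBlock_rateCarriers_of_pinnedLoose` — `hlinkTrim`'s N16-letter block VERBATIM at `(c', t) := (c' F, c' F)` at
the carriers `R.ne3` of every tuple under the pin.  After this file the only `R.ne3`-reading conjuncts of `hlinkTrim` not produced from `h5` + the slot key are CONTENT rows
(`LeafH3sup 4 L Nper ε b c' dom` at the squeezed tolerances on the loose data, the `sel` rows, the `γ₃` letter) — NODE O ∕ node N07's world.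

PRICE ∕ HONEST FRAMING.  As module 49: loose data radius `ε∕B ≤ 2^-78·L^-12·ε` (near-flat), `g` is N16's OUTPUT `gradConst 4 c'`; kernel bookkeeping by name; no estimate;
`h5` (node N05's Thm-4 ∕ Prop-3 bodies at exponent β on the pinned all-torus sub-family) and the slot key `hR` ([Balaban1985Variational] Thm 1 (9)–(10) at leaf-06's torus
objects ON THE SLOT CUBES — node N07's content) are DISPLAYED hypotheses asserted for no family; nothing of Bałaban asserted or refuted; no stub of K3⁸ closed; N16 ∕ N07 ∕
N19 ∕ N21 NOT discharged; the skeleton (v6 b4e55110ab73e679) is the planner's and is NOT edited; counts UNMOVED (typed 28∕28 · discharged 5∕27, A 5∕28); one finite four-torus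
at fixed ε — NOT ℝ⁴ ∕ infinite volume ∕ OS ∕ mass gap ∕ Clay.
-/

set_option autoImplicit false

open scoped BigOperators Matrix Matrix.Norms.L2Operator
open NormedSpace

namespace Summit.QuantumFields.YangMills.BalabanUVNodes.N16PinnedLooseMatchSqueezeClassRadius

open Literature.MathematicalPhysics.QuantumFieldTheory.Balaban1983to89
open Literature.MathematicalPhysics.QuantumFieldTheory.Balaban1983to89.T4Continuum (T4Family ULoop)
open B7Prop1Explicit B7Prop2Explicit MatrixLog UnitaryModel
open T4AveragingDeficitWall hiding Site Plane Plaq Bond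
open B7Prop3Flat (c3)
open B8LeafModelZd (ZdIdx)
open B8LeafModelZd3 (zdGF3)
open Node00 (Stage13HParams NE3Objects₁₁ NE3Letters₁₁ ne3ConstLayerOfRecord₁₁ ne3NperOfRecord₁₁ ne3DomOfRecord₁₁ one_le_ne3NperOfRecord₁₁ MatA)
open Summit.QuantumFields.BalabanUV.T4Continuum
open BlockAverageCurrent (curConst)
open NE3RightInverseSupLetters (frameC)
open NE3.LeafIndexSockets (LeafH3sup)
open MinimalActionSandwich (IsMinimiser)
open MinimalActionRate (sfClass)
open MinimalActionRefine (gradConst)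
open MinimalActionDictionary (torusVP RadiiMono)
open AveragingDeficitLatticeH2Prep (fd)
open B11 (Regularity)
open YMDAG.UVSplit (NE3Carriers ne3OfRecord₁₁ RateReading₁₃CoPH rateCarriersOfRecord₁₃CoPH)
open Summit.QuantumFields.YangMills.BalabanUVNodes.N16HolderDefs (N16HolderAt)
open Summit.QuantumFields.YangMills.BalabanUVNodes.N16HolderRegime (InEndRegimeH radiusOfRecordH constOfRecordH radiusOfRecordH_pos)
open Summit.QuantumFields.YangMills.BalabanUVNodes.N16HolderSlotWindow (inEndRegimeH_ofRecord_of_window)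
open Summit.QuantumFields.YangMills.BalabanUVNodes.N16AtRecord13OfEdges (exists_window_letters_linearLeaf)
open Summit.QuantumFields.YangMills.BalabanUVNodes.N16LeafSlotAllTorus (LeafSlotHolderAT n16HolderAt_of_inEndRegimeH_leafSlotHolderAT)
open Summit.QuantumFields.YangMills.BalabanUVNodes.N16SlotWindowAllTorus (leafSlotHolderAT_ofRecord_of_window_linear)
open Summit.QuantumFields.YangMills.BalabanUVNodes.N16H7LooseOfReg910Slot (h7Shape_loose_of_reg910Slot)
open Summit.QuantumFields.YangMills.BalabanUVNodes.N16PinnedLayer13CoPH (N16PinnedLoose N16LettersEnd N16HolderAtReading n16HolderAtReading_of_pinnedLoose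
  rateCarriers_ne3_of_pinnedLoose)
open Summit.QuantumFields.YangMills.BalabanUVNodes.N16PinnedLooseMatch (n16HolderAt_anti_dom looseDom_anti)
open Summit.QuantumFields.YangMills.BalabanUVNodes.N16 (gradConst_four_pos)
open Summit.QuantumFields.YangMills.BalabanUVNodes.N16PinnedLooseMatchSqueeze (leafSlotHolderAT_reletter inEndRegimeH_reletter squeezeLetters_spec)

noncomputable section

variable {N : ℕ} [NeZero N] {β : ℝ}

/-! ## §1 Per family: letters of record at the loose object from `h5` and a loose linear leaf, WITH THE TWO CLASS-RADIUS ROWS exported -/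

/-- **PER FAMILY, AT THE LOOSE-DATA OBJECT, WITH THE CLASS-RADIUS ROWS** — dag-n16-w1's `…N16H7LooseOfThm1At.exists_letters_inEndRegimeH_leafSlotHolderAT_of_edges_loose`
(letters of record `ℓ` with `ℓ.g = g`, `ℓ.Λ₁ =` THE END's radius, `ℓ.C =` its constant, `0 < ℓ.b`, N21's numeral, `0 < ℓ.Λ₂'`, and `InEndRegimeH ∧ LeafSlotHolderAT · β` at
`oL = {ne3ConstLayerOfRecord₁₁ F N ℓ with dom := loose data at radius ℓ.ε∕B}`, from node N05's `h5` and a loose linear leaf `h7L`) PLUS the two rows on the CLASS radius that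
node N19′'s link reading displays: `16·C0 4·ℓ.ε ≤ 3` and `1024·(4+1)·(4+4)·(F.L)²·ℓ.ε ≤ 1` — read off this seat's window lemma (`ℓ.ε < α`, `α ≤ c2' 4 F.L ∕ 2`, `α ≤ 1∕10^9`).
Proof = file 6 §1's, two arithmetic lines added. [folklore] -/
theorem exists_letters_inEndRegimeH_leafSlotHolderAT_classRadius_of_edges_loose (F : T4Family) {g : ℝ} (hg : 0 < g)
    (h5 : letI : CStarAlgebra (Matrix (Fin N) (Fin N) ℂ) := {}
      ∃ (len : Site 4 → ℝ) (c₁ c₁' B₁' cP C₂ B₀β : ℝ) (inp : B8.B9Inputs),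
        (∀ v : Site 4, 0 < len v → 1 ≤ len v) ∧ (∀ μ : Fin 4, len (e μ) = 1) ∧ 0 < B₁' ∧ 5 * ((4 : ℕ) : ℝ) * F.L * inp.B₀ ≤ B₁' ∧ 0 < c₁' ∧
        (∀ α₀ α₁ : ℝ, 0 < α₀ → 0 < α₁ → α₀ + α₁ ≤ c₁' →
          α₀ + α₁ ≤ c₁ ∧ C0 4 * (2 * α₀) ≤ 1 / 3 ∧ 4 * α₀ ≤ c2' 4 F.L ∧ 16 * (B₁' * (α₀ + α₁)) ≤ 1 ∧
          Real.exp (4 * (800 * (((4 : ℕ) : ℝ) + 1) ^ 2 * (((4 : ℕ) : ℝ) + 4)) * α₀) * (1 + 8 * (131072 * (((4 : ℕ) : ℝ) + 1) ^ 2) * (B₁' * (α₀ + α₁))) ≤ 2 ∧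
          2 * (B₁' * (α₀ + α₁)) ≤ c3 4 F.L ∧ ((4 : ℕ) : ℝ) * F.L * α₁ ≤ 1 / 8 ∧ α₀ ≤ cP ∧ α₁ ≤ cP ∧ B₁' * (α₀ + α₁) ≤ cP ∧
          2 * (B₁' * (α₀ + α₁)) ^ 2 + 20 * ((4 : ℕ) : ℝ) * α₀ * (B₁' * (α₀ + α₁)) + 2 * C₂ * (B₁' * (α₀ + α₁)) ^ 2 ≤ α₀ + α₁) ∧
        B8.Thm4Body c₁ B₁' (fun i : {i : ZdIdx 4 F.L // (∀ j, i.Ω j = Set.univ) ∧ (∀ m j, i.Λs m j = {_y | j = m}) ∧ (∀ m j, i.Λb m j = {_c | j = m}) ∧ i.η = ((F.L : ℝ)⁻¹) ^ i.k} => (zdGF3 (Matrix (Fin N) (Fin N) ℂ) F.L β len i.1).toGFData) ∧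
        B8.Prop3Body cP 4 (F.L : ℝ) C₂ inp B₀β (fun i : {i : ZdIdx 4 F.L // (∀ j, i.Ω j = Set.univ) ∧ (∀ m j, i.Λs m j = {_y | j = m}) ∧ (∀ m j, i.Λb m j = {_c | j = m}) ∧ i.η = ((F.L : ℝ)⁻¹) ^ i.k} => (zdGF3 (Matrix (Fin N) (Fin N) ℂ) F.L β len i.1).toGFData2))
    {B : ℝ}
    (h7L : ∃ C ε₀ : ℝ, 0 ≤ C ∧ 0 < ε₀ ∧ ∀ ε : ℝ, 0 < ε → ε ≤ ε₀ →
      LeafH3sup 4 F.L (ne3NperOfRecord₁₁ F 0 0) ε (C * ε) (C * ε)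
        {V | V ∈ ne3DomOfRecord₁₁ F N 0 0 ∧ V ∈ sfClass 4 F.L (ne3NperOfRecord₁₁ F 0 0) (ε / B) 0}) :
    ∃ ℓ : NE3Letters₁₁, ℓ.g = g ∧ ℓ.Λ₁ = radiusOfRecordH N F.L (ne3NperOfRecord₁₁ F 0 0) ∧ ℓ.C = constOfRecordH N F.L (ne3NperOfRecord₁₁ F 0 0) g ∧
      0 < ℓ.b ∧ 512 * (4 + 1) * (4 + 4) * (F.L : ℝ) ^ 2 * ℓ.b ≤ 1 ∧ 0 < ℓ.Λ₂' ∧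
      16 * C0 4 * ℓ.ε ≤ 3 ∧ 1024 * (4 + 1) * (4 + 4) * (F.L : ℝ) ^ 2 * ℓ.ε ≤ 1 ∧
      InEndRegimeH (ne3OfRecord₁₁ F
        { ne3ConstLayerOfRecord₁₁ F N ℓ with
          dom := {V | V ∈ ne3DomOfRecord₁₁ F N 0 0 ∧ V ∈ sfClass 4 F.L (ne3NperOfRecord₁₁ F 0 0) (ℓ.ε / B) 0} }) ∧
      LeafSlotHolderAT (ne3OfRecord₁₁ F
        { ne3ConstLayerOfRecord₁₁ F N ℓ with
          dom := {V | V ∈ ne3DomOfRecord₁₁ F N 0 0 ∧ V ∈ sfClass 4 F.L (ne3NperOfRecord₁₁ F 0 0) (ℓ.ε / B) 0} }) β := by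
  letI : CStarAlgebra (Matrix (Fin N) (Fin N) ℂ) := {}
  obtain ⟨len, c₁, c₁', B₁', cP, C₂, B₀β, inp, hlen, hlen1, hB₁', hBB, hc₁', hwin, hT, hP⟩ := h5
  obtain ⟨C, ε₀, hC, hε₀, h3⟩ := h7L
  have hL : 2 ≤ F.L := HistoryFlow.two_le_L F
  obtain ⟨α, ℓ, hα, hα1, hα2, hα3, hα4, hα5, hgℓ, hε0, hε, hεε₀, hCε, hεr, hΛ₁, hb0, hb, hCℓ, hΛ₂', hΛ₂'0, hnum⟩ :=
    exists_window_letters_linearLeaf F hc₁' inp B₀β g (radiusOfRecordH_pos (N := N) hL (one_le_ne3NperOfRecord₁₁ F 0 0))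
      (constOfRecordH N F.L (ne3NperOfRecord₁₁ F 0 0) g) hC hε₀
  -- the two CLASS-RADIUS rows, from `ℓ.ε < α ≤ min (c2' 4 F.L ∕ 2) (1∕10^9)`
  have hrowC : 16 * C0 4 * ℓ.ε ≤ 3 := by
    have hC0 : C0 4 = 23142400 := by simp only [C0]; norm_num
    have h9 : ℓ.ε ≤ 1 / 10 ^ 9 := hε.le.trans hα5
    rw [hC0]
    linarith
  have hrowL : 1024 * (4 + 1) * (4 + 4) * (F.L : ℝ) ^ 2 * ℓ.ε ≤ 1 := by
    have hc2 : c2' 4 F.L = 1 / (512 * ((4 : ℝ) + 1) * (4 + 4) * (F.L : ℝ) ^ 2) := by simp only [c2']; push_cast; ring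
    have hK : 0 < 512 * ((4 : ℝ) + 1) * (4 + 4) * (F.L : ℝ) ^ 2 := by positivity
    have h1 : ℓ.ε ≤ 1 / (512 * ((4 : ℝ) + 1) * (4 + 4) * (F.L : ℝ) ^ 2) / 2 := hε.le.trans (hc2 ▸ hα3)
    rw [le_div_iff₀ (by norm_num : (0 : ℝ) < 2), le_div_iff₀ hK] at h1
    linarith
  -- the loose-data object at the chosen radius (file 6 §1 verbatim from here)
  set oL : NE3Objects₁₁ N := { ne3ConstLayerOfRecord₁₁ F N ℓ with
      dom := {V | V ∈ ne3DomOfRecord₁₁ F N 0 0 ∧ V ∈ sfClass 4 F.L (ne3NperOfRecord₁₁ F 0 0) (ℓ.ε / B) 0} } with hoL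
  have hB0 : 0 < 5 * ((4 : ℕ) : ℝ) * F.L * inp.B₀ := by have := inp.B₀_pos; positivity
  have hΛpos : 0 < ℓ.Λ₁ := by rw [hΛ₁]; exact radiusOfRecordH_pos (N := N) hL (one_le_ne3NperOfRecord₁₁ F 0 0)
  have hgpos : 0 < ℓ.g := by rw [hgℓ]; exact hg
  refine ⟨ℓ, hgℓ, hΛ₁, hCℓ, hb0, hnum, hΛ₂'0, hrowC, hrowL,
    inEndRegimeH_ofRecord_of_window F oL (one_le_ne3NperOfRecord₁₁ F 0 0) hgpos hB0.le hα2 hε0 hε hΛ₁.le hb0.le hb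
      (show constOfRecordH N F.L (ne3NperOfRecord₁₁ F 0 0) ℓ.g ≤ ℓ.C by rw [hCℓ, hgℓ]), ?_⟩
  have hCε0 : 0 ≤ C * ℓ.ε := mul_nonneg hC hε0.le
  exact leafSlotHolderAT_ofRecord_of_window_linear F oL hlen hlen1 hB₁' hBB hc₁' hwin hα hα1 hα2 hα3 hα4 hα5 hε hΛpos hΛ₂' hCε0 hCε hCε0
    (hCε.trans (by linarith only [hα.le] : α / 2048 ≤ α / 24)) hT hP (h3 ℓ.ε hε0 hεε₀)

/-! ## §2 Per family at the SLOT KEY (§1 ∘ dag-n16-w1's `h7Shape_loose_of_reg910Slot`, as (9b)) -/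

/-- **PER FAMILY, AT THE LOOSE OBJECT OF RADIUS `ℓ.ε ∕ C.B₃`, FROM `h5` AND THE SLOT KEY, WITH THE CLASS-RADIUS ROWS** — dag-n16-w1's (9b)
`exists_letters_inEndRegimeH_leafSlotHolderAT_of_h5_reg910Slot` with §1's two extra exported rows. [cite: Balaban1985Variational, Thm 1 (9)–(10) p.279] [folklore] -/
theorem exists_letters_inEndRegimeH_leafSlotHolderAT_classRadius_of_h5_reg910Slot (F : T4Family) {g : ℝ} (hg : 0 < g)
    (h5 : letI : CStarAlgebra (Matrix (Fin N) (Fin N) ℂ) := {}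
      ∃ (len : Site 4 → ℝ) (c₁ c₁' B₁' cP C₂ B₀β : ℝ) (inp : B8.B9Inputs),
        (∀ v : Site 4, 0 < len v → 1 ≤ len v) ∧ (∀ μ : Fin 4, len (e μ) = 1) ∧ 0 < B₁' ∧ 5 * ((4 : ℕ) : ℝ) * F.L * inp.B₀ ≤ B₁' ∧ 0 < c₁' ∧
        (∀ α₀ α₁ : ℝ, 0 < α₀ → 0 < α₁ → α₀ + α₁ ≤ c₁' →
          α₀ + α₁ ≤ c₁ ∧ C0 4 * (2 * α₀) ≤ 1 / 3 ∧ 4 * α₀ ≤ c2' 4 F.L ∧ 16 * (B₁' * (α₀ + α₁)) ≤ 1 ∧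
          Real.exp (4 * (800 * (((4 : ℕ) : ℝ) + 1) ^ 2 * (((4 : ℕ) : ℝ) + 4)) * α₀) * (1 + 8 * (131072 * (((4 : ℕ) : ℝ) + 1) ^ 2) * (B₁' * (α₀ + α₁))) ≤ 2 ∧
          2 * (B₁' * (α₀ + α₁)) ≤ c3 4 F.L ∧ ((4 : ℕ) : ℝ) * F.L * α₁ ≤ 1 / 8 ∧ α₀ ≤ cP ∧ α₁ ≤ cP ∧ B₁' * (α₀ + α₁) ≤ cP ∧
          2 * (B₁' * (α₀ + α₁)) ^ 2 + 20 * ((4 : ℕ) : ℝ) * α₀ * (B₁' * (α₀ + α₁)) + 2 * C₂ * (B₁' * (α₀ + α₁)) ^ 2 ≤ α₀ + α₁) ∧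
        B8.Thm4Body c₁ B₁' (fun i : {i : ZdIdx 4 F.L // (∀ j, i.Ω j = Set.univ) ∧ (∀ m j, i.Λs m j = {_y | j = m}) ∧ (∀ m j, i.Λb m j = {_c | j = m}) ∧ i.η = ((F.L : ℝ)⁻¹) ^ i.k} => (zdGF3 (Matrix (Fin N) (Fin N) ℂ) F.L β len i.1).toGFData) ∧
        B8.Prop3Body cP 4 (F.L : ℝ) C₂ inp B₀β (fun i : {i : ZdIdx 4 F.L // (∀ j, i.Ω j = Set.univ) ∧ (∀ m j, i.Λs m j = {_y | j = m}) ∧ (∀ m j, i.Λb m j = {_c | j = m}) ∧ i.η = ((F.L : ℝ)⁻¹) ^ i.k} => (zdGF3 (Matrix (Fin N) (Fin N) ℂ) F.L β len i.1).toGFData2))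
    {G : (Site 4 → Fin 4 → (MatA N)ˣ) → Site 4 → ℕ → ℝ → ℝ → ℝ → Prop} (hGm : RadiiMono 4 G)
    (hG : ∀ (U : Site 4 → Fin 4 → (MatA N)ˣ) (x : Site 4) (K : ℕ) (α₀ α₁ α₂ : ℝ), 2 ≤ K → G U x K α₀ α₁ α₂ →
      ∃ (u : Site 4 → (MatA N)ˣ) (a : Site 4 → Fin 4 → MatA N),
        (∀ z, u z ∈ unitaryUnits (MatA N)) ∧
        (∀ (y : Site 4) (τ : Fin 4), l1 (y - x) ≤ 2 → ((gaugeAct u U y τ : (MatA N)ˣ) : MatA N) = exp (a y τ)) ∧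
        (∀ (y : Site 4) (τ : Fin 4), l1 (y - x) ≤ 2 → ‖a y τ‖ ≤ α₀) ∧
        (∀ (y : Site 4) (τ i : Fin 4), l1 (y - x) ≤ 1 → ‖fd i (fun z => a z τ) y‖ ≤ α₁) ∧
        (∀ (τ i l : Fin 4), ‖fd i (fd l (fun z => a z τ)) x‖ ≤ α₂))
    (C : B11Thm1.Consts)
    (hR : ∀ (k : ℕ) (ε₁ : ℝ), 0 < ε₁ → ε₁ ≤ C.a₁ → ∀ (V U : Site 4 → Fin 4 → (MatA N)ˣ), V ∈ sfClass 4 F.L (ne3NperOfRecord₁₁ F 0 0) ε₁ 0 →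
      IsMinimiser 4 (sfClass 4 F.L (ne3NperOfRecord₁₁ F 0 0) (C.B₃ * ε₁)) F.L (ne3NperOfRecord₁₁ F 0 0) (k + 1) V U →
        ∀ x : Site 4, Regularity (torusVP 4 F.L (ne3NperOfRecord₁₁ F 0 0) G (k + 1)) C.B₃ C.B₄ ε₁ U (x, F.L ^ (k + 1) - 1 + F.L ^ (k + 1) + 2)) :
    ∃ ℓ : NE3Letters₁₁, ℓ.g = g ∧ ℓ.Λ₁ = radiusOfRecordH N F.L (ne3NperOfRecord₁₁ F 0 0) ∧ ℓ.C = constOfRecordH N F.L (ne3NperOfRecord₁₁ F 0 0) g ∧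
      0 < ℓ.b ∧ 512 * (4 + 1) * (4 + 4) * (F.L : ℝ) ^ 2 * ℓ.b ≤ 1 ∧ 0 < ℓ.Λ₂' ∧
      16 * C0 4 * ℓ.ε ≤ 3 ∧ 1024 * (4 + 1) * (4 + 4) * (F.L : ℝ) ^ 2 * ℓ.ε ≤ 1 ∧
      InEndRegimeH (ne3OfRecord₁₁ F
        { ne3ConstLayerOfRecord₁₁ F N ℓ with
          dom := {V | V ∈ ne3DomOfRecord₁₁ F N 0 0 ∧ V ∈ sfClass 4 F.L (ne3NperOfRecord₁₁ F 0 0) (ℓ.ε / C.B₃) 0} }) ∧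
      LeafSlotHolderAT (ne3OfRecord₁₁ F
        { ne3ConstLayerOfRecord₁₁ F N ℓ with
          dom := {V | V ∈ ne3DomOfRecord₁₁ F N 0 0 ∧ V ∈ sfClass 4 F.L (ne3NperOfRecord₁₁ F 0 0) (ℓ.ε / C.B₃) 0} }) β :=
  exists_letters_inEndRegimeH_leafSlotHolderAT_classRadius_of_edges_loose F hg h5
    (h7Shape_loose_of_reg910Slot (le_trans one_le_two (HistoryFlow.two_le_L F)) hGm hG C hR (ne3DomOfRecord₁₁ F N 0 0))

/-! ## §3 ★ The producer with ALL NINE N16-letter rows (module 49 §3's shape; the coupling letter is OUTPUT) -/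

section Producer

variable (hβ0 : 0 ≤ β) (hβ1 : β ≤ 1)
include hβ0 hβ1

/-- **★ THE PRODUCER OF THE THREE N16 CONJUNCTS WITH NODE N19′'s COMPLETE N16-LETTER BLOCK** — module 49's ★ `exists_letters_n16HolderAtReading_loose_squeeze_of_h5_reg910Slot`
(from node N05's `h5`, a local-gauge shape `G F` with the (9)_{β₀=1} interface, constants `C F`, the SLOT KEY `hR`; letters `ℓ₃`, radius letter `B F := max (C F).B₃ (4ε∕c' F)`,
sup letter `c' F := min (ε∕(2^76·L^12)) (1∕(2^91·L^17))`, `(ℓ₃ F).b := c' F`, `(ℓ₃ F).g := gradConst 4 (c' F)`) with the rows conjunct now carrying, besides the radii rows, the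
two CLASS-RADIUS rows `16·C0 4·(ℓ₃ F).ε ≤ 3 ∧ 1024·(4+1)·(4+4)·(F.L)²·(ℓ₃ F).ε ≤ 1` (§2). [cite: Balaban1985Variational, Thm 1 (9)–(10) p.279] [folklore] -/
theorem exists_letters_n16HolderAtReading_loose_squeezeFull_of_h5_reg910Slot
    (h5 : ∀ F : T4Family, letI : CStarAlgebra (Matrix (Fin N) (Fin N) ℂ) := {}
      ∃ (len : Site 4 → ℝ) (c₁ c₁' B₁' cP C₂ B₀β : ℝ) (inp : B8.B9Inputs),
        (∀ v : Site 4, 0 < len v → 1 ≤ len v) ∧ (∀ μ : Fin 4, len (e μ) = 1) ∧ 0 < B₁' ∧ 5 * ((4 : ℕ) : ℝ) * F.L * inp.B₀ ≤ B₁' ∧ 0 < c₁' ∧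
        (∀ α₀ α₁ : ℝ, 0 < α₀ → 0 < α₁ → α₀ + α₁ ≤ c₁' →
          α₀ + α₁ ≤ c₁ ∧ C0 4 * (2 * α₀) ≤ 1 / 3 ∧ 4 * α₀ ≤ c2' 4 F.L ∧ 16 * (B₁' * (α₀ + α₁)) ≤ 1 ∧
          Real.exp (4 * (800 * (((4 : ℕ) : ℝ) + 1) ^ 2 * (((4 : ℕ) : ℝ) + 4)) * α₀) * (1 + 8 * (131072 * (((4 : ℕ) : ℝ) + 1) ^ 2) * (B₁' * (α₀ + α₁))) ≤ 2 ∧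
          2 * (B₁' * (α₀ + α₁)) ≤ c3 4 F.L ∧ ((4 : ℕ) : ℝ) * F.L * α₁ ≤ 1 / 8 ∧ α₀ ≤ cP ∧ α₁ ≤ cP ∧ B₁' * (α₀ + α₁) ≤ cP ∧
          2 * (B₁' * (α₀ + α₁)) ^ 2 + 20 * ((4 : ℕ) : ℝ) * α₀ * (B₁' * (α₀ + α₁)) + 2 * C₂ * (B₁' * (α₀ + α₁)) ^ 2 ≤ α₀ + α₁) ∧
        B8.Thm4Body c₁ B₁' (fun i : {i : ZdIdx 4 F.L // (∀ j, i.Ω j = Set.univ) ∧ (∀ m j, i.Λs m j = {_y | j = m}) ∧ (∀ m j, i.Λb m j = {_c | j = m}) ∧ i.η = ((F.L : ℝ)⁻¹) ^ i.k} => (zdGF3 (Matrix (Fin N) (Fin N) ℂ) F.L β len i.1).toGFData) ∧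
        B8.Prop3Body cP 4 (F.L : ℝ) C₂ inp B₀β (fun i : {i : ZdIdx 4 F.L // (∀ j, i.Ω j = Set.univ) ∧ (∀ m j, i.Λs m j = {_y | j = m}) ∧ (∀ m j, i.Λb m j = {_c | j = m}) ∧ i.η = ((F.L : ℝ)⁻¹) ^ i.k} => (zdGF3 (Matrix (Fin N) (Fin N) ℂ) F.L β len i.1).toGFData2))
    {G : T4Family → (Site 4 → Fin 4 → (MatA N)ˣ) → Site 4 → ℕ → ℝ → ℝ → ℝ → Prop} (hGm : ∀ F, RadiiMono 4 (G F))
    (hG : ∀ (F : T4Family) (U : Site 4 → Fin 4 → (MatA N)ˣ) (x : Site 4) (K : ℕ) (α₀ α₁ α₂ : ℝ), 2 ≤ K → G F U x K α₀ α₁ α₂ →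
      ∃ (u : Site 4 → (MatA N)ˣ) (a : Site 4 → Fin 4 → MatA N),
        (∀ z, u z ∈ unitaryUnits (MatA N)) ∧
        (∀ (y : Site 4) (τ : Fin 4), l1 (y - x) ≤ 2 → ((gaugeAct u U y τ : (MatA N)ˣ) : MatA N) = exp (a y τ)) ∧
        (∀ (y : Site 4) (τ : Fin 4), l1 (y - x) ≤ 2 → ‖a y τ‖ ≤ α₀) ∧
        (∀ (y : Site 4) (τ i : Fin 4), l1 (y - x) ≤ 1 → ‖fd i (fun z => a z τ) y‖ ≤ α₁) ∧
        (∀ (τ i l : Fin 4), ‖fd i (fd l (fun z => a z τ)) x‖ ≤ α₂))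
    (C : T4Family → B11Thm1.Consts)
    (hR : ∀ (F : T4Family) (k : ℕ) (ε₁ : ℝ), 0 < ε₁ → ε₁ ≤ (C F).a₁ → ∀ (V U : Site 4 → Fin 4 → (MatA N)ˣ), V ∈ sfClass 4 F.L (ne3NperOfRecord₁₁ F 0 0) ε₁ 0 →
      IsMinimiser 4 (sfClass 4 F.L (ne3NperOfRecord₁₁ F 0 0) ((C F).B₃ * ε₁)) F.L (ne3NperOfRecord₁₁ F 0 0) (k + 1) V U →
        ∀ x : Site 4, Regularity (torusVP 4 F.L (ne3NperOfRecord₁₁ F 0 0) (G F) (k + 1)) (C F).B₃ (C F).B₄ ε₁ U (x, F.L ^ (k + 1) - 1 + F.L ^ (k + 1) + 2)) :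
    ∃ (ℓ₃ : T4Family → NE3Letters₁₁) (B c' : T4Family → ℝ), N16LettersEnd N (fun F => gradConst 4 (c' F)) ℓ₃ ∧
      (∀ F : T4Family, 0 < B F ∧ (ℓ₃ F).ε / B F ≤ (ℓ₃ F).b) ∧
      (∀ F : T4Family, (C F).B₃ ≤ B F ∧ (2 : ℝ) ^ 78 * (F.L : ℝ) ^ 12 ≤ B F) ∧
      (∀ F : T4Family, (ℓ₃ F).g = gradConst 4 (c' F) ∧ 0 ≤ c' F ∧ 0 < c' F ∧ (ℓ₃ F).b ≤ c' F ∧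
        (2 : ℝ) ^ 91 * (F.L : ℝ) ^ 17 * c' F ≤ 1 ∧ (2 : ℝ) ^ 76 * (F.L : ℝ) ^ 12 * c' F ≤ (ℓ₃ F).ε ∧
        16 * C0 4 * (ℓ₃ F).ε ≤ 3 ∧ 1024 * (4 + 1) * (4 + 4) * (F.L : ℝ) ^ 2 * (ℓ₃ F).ε ≤ 1 ∧
        (ℓ₃ F).ε / B F ≤ 1 / 4 ∧ 4 * ((ℓ₃ F).ε / B F) ≤ c' F) ∧
      ∀ 𝔯 : RateReading₁₃CoPH N, N16PinnedLoose 𝔯 ℓ₃ B → N16HolderAtReading 𝔯 β := by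
  -- the letters of record at the loose object of radius `ε ∕ B₃`, from `h5` and the slot key, at the auxiliary coupling letter `1`, with the class-radius rows
  choose ℓ hℓ using fun F => exists_letters_inEndRegimeH_leafSlotHolderAT_classRadius_of_h5_reg910Slot (N := N) F one_pos (h5 F) (hGm F) (hG F) (C F) (hR F)
  have hε0 : ∀ F, 0 < (ℓ F).ε := fun F => (hℓ F).2.2.2.2.2.2.2.2.1.2.2.2.1
  have hL1 : ∀ F : T4Family, (1 : ℝ) ≤ F.L := fun F => by exact_mod_cast le_trans one_le_two (HistoryFlow.two_le_L F)
  -- the squeezed scalars per family (module 49)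
  have hs := fun F => squeezeLetters_spec (hL1 F) (hε0 F) (C F).B₃_pos
  refine ⟨fun F => ⟨(ℓ F).ε, min ((ℓ F).ε / ((2 : ℝ) ^ 76 * (F.L : ℝ) ^ 12)) (1 / ((2 : ℝ) ^ 91 * (F.L : ℝ) ^ 17)),
      gradConst 4 (min ((ℓ F).ε / ((2 : ℝ) ^ 76 * (F.L : ℝ) ^ 12)) (1 / ((2 : ℝ) ^ 91 * (F.L : ℝ) ^ 17))),
      constOfRecordH N F.L (ne3NperOfRecord₁₁ F 0 0) (gradConst 4 (min ((ℓ F).ε / ((2 : ℝ) ^ 76 * (F.L : ℝ) ^ 12)) (1 / ((2 : ℝ) ^ 91 * (F.L : ℝ) ^ 17)))),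
      (ℓ F).Λ₁, (ℓ F).Λ₂'⟩,
    fun F => max (C F).B₃ (4 * (ℓ F).ε / min ((ℓ F).ε / ((2 : ℝ) ^ 76 * (F.L : ℝ) ^ 12)) (1 / ((2 : ℝ) ^ 91 * (F.L : ℝ) ^ 17))),
    fun F => min ((ℓ F).ε / ((2 : ℝ) ^ 76 * (F.L : ℝ) ^ 12)) (1 / ((2 : ℝ) ^ 91 * (F.L : ℝ) ^ 17)),
    fun F => ⟨rfl, (hℓ F).2.1, rfl, (hs F).1, (hs F).2.2.2.2.1, (hℓ F).2.2.2.2.2.1, ?_⟩,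
    fun F => ⟨(hs F).2.2.2.2.2.1, (hs F).2.2.2.2.2.2.2.1⟩, fun F => ⟨(hs F).2.2.2.2.2.2.1, (hs F).2.2.2.2.2.2.2.2.2.2⟩,
    fun F => ⟨rfl, (hs F).1.le, (hs F).1, le_rfl, (hs F).2.1, (hs F).2.2.1, (hℓ F).2.2.2.2.2.2.1, (hℓ F).2.2.2.2.2.2.2.1,
      (hs F).2.2.2.2.2.2.2.2.1, (hs F).2.2.2.2.2.2.2.2.2.1⟩,
    fun 𝔯 hpin => n16HolderAtReading_of_pinnedLoose β hpin fun F => ?_⟩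
  · -- THE END's regime at the re-lettered constant layer (module 49 §1 transport of §2's `InEndRegimeH`; the regime does not read the data)
    have hreg := inEndRegimeH_reletter F _ (ne3DomOfRecord₁₁ F N 0 0) (hℓ F).2.2.2.2.2.2.2.2.1 (gradConst_four_pos (hs F).1) (hs F).1.le (hs F).2.2.2.1 le_rfl
    exact hreg
  · -- the N16 conjunct: closer at radius `ε ∕ B₃` on the re-lettered loose object, then antitonicity down to radius `ε ∕ B`
    have hreg := inEndRegimeH_reletter F _ {V | V ∈ ne3DomOfRecord₁₁ F N 0 0 ∧ V ∈ sfClass 4 F.L (ne3NperOfRecord₁₁ F 0 0) ((ℓ F).ε / (C F).B₃) 0}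
      (hℓ F).2.2.2.2.2.2.2.2.1 (gradConst_four_pos (hs F).1) (hs F).1.le (hs F).2.2.2.1 le_rfl
    have hH := n16HolderAt_of_inEndRegimeH_leafSlotHolderAT hreg hβ0 hβ1 (leafSlotHolderAT_reletter F _ _ _ _ (hℓ F).2.2.2.2.2.2.2.2.2)
    have hres := n16HolderAt_anti_dom F (looseDom_anti F (hε0 F).le (C F).B₃_pos (hs F).2.2.2.2.2.2.1) hH
    exact hres

/-! ## §4 The K3-stub-1 shape: the coupling letter displayed as a function `g` -/

/-- **★ THE SAME IN K3's STUB-1 SHAPE `∃ ℓ₃ g B`**: letters `ℓ₃`, coupling letter `g` (`> 0`, `g F = gradConst 4 (c' F)`), radius letter `B`, sup letter `c'`, with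
`N16LettersEnd N g ℓ₃`, the MATCH row, the floor, ALL NINE N16-letter rows of node N19′ at `t := c' F`, and the N16 conjunct at every reading pinned loose at `ℓ₃, B`.
[cite: Balaban1985Variational, Thm 1 (9)–(10) p.279] [folklore] -/
theorem exists_letters_g_n16HolderAtReading_loose_squeezeFull_of_h5_reg910Slot
    (h5 : ∀ F : T4Family, letI : CStarAlgebra (Matrix (Fin N) (Fin N) ℂ) := {}
      ∃ (len : Site 4 → ℝ) (c₁ c₁' B₁' cP C₂ B₀β : ℝ) (inp : B8.B9Inputs),
        (∀ v : Site 4, 0 < len v → 1 ≤ len v) ∧ (∀ μ : Fin 4, len (e μ) = 1) ∧ 0 < B₁' ∧ 5 * ((4 : ℕ) : ℝ) * F.L * inp.B₀ ≤ B₁' ∧ 0 < c₁' ∧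
        (∀ α₀ α₁ : ℝ, 0 < α₀ → 0 < α₁ → α₀ + α₁ ≤ c₁' →
          α₀ + α₁ ≤ c₁ ∧ C0 4 * (2 * α₀) ≤ 1 / 3 ∧ 4 * α₀ ≤ c2' 4 F.L ∧ 16 * (B₁' * (α₀ + α₁)) ≤ 1 ∧
          Real.exp (4 * (800 * (((4 : ℕ) : ℝ) + 1) ^ 2 * (((4 : ℕ) : ℝ) + 4)) * α₀) * (1 + 8 * (131072 * (((4 : ℕ) : ℝ) + 1) ^ 2) * (B₁' * (α₀ + α₁))) ≤ 2 ∧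
          2 * (B₁' * (α₀ + α₁)) ≤ c3 4 F.L ∧ ((4 : ℕ) : ℝ) * F.L * α₁ ≤ 1 / 8 ∧ α₀ ≤ cP ∧ α₁ ≤ cP ∧ B₁' * (α₀ + α₁) ≤ cP ∧
          2 * (B₁' * (α₀ + α₁)) ^ 2 + 20 * ((4 : ℕ) : ℝ) * α₀ * (B₁' * (α₀ + α₁)) + 2 * C₂ * (B₁' * (α₀ + α₁)) ^ 2 ≤ α₀ + α₁) ∧
        B8.Thm4Body c₁ B₁' (fun i : {i : ZdIdx 4 F.L // (∀ j, i.Ω j = Set.univ) ∧ (∀ m j, i.Λs m j = {_y | j = m}) ∧ (∀ m j, i.Λb m j = {_c | j = m}) ∧ i.η = ((F.L : ℝ)⁻¹) ^ i.k} => (zdGF3 (Matrix (Fin N) (Fin N) ℂ) F.L β len i.1).toGFData) ∧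
        B8.Prop3Body cP 4 (F.L : ℝ) C₂ inp B₀β (fun i : {i : ZdIdx 4 F.L // (∀ j, i.Ω j = Set.univ) ∧ (∀ m j, i.Λs m j = {_y | j = m}) ∧ (∀ m j, i.Λb m j = {_c | j = m}) ∧ i.η = ((F.L : ℝ)⁻¹) ^ i.k} => (zdGF3 (Matrix (Fin N) (Fin N) ℂ) F.L β len i.1).toGFData2))
    {G : T4Family → (Site 4 → Fin 4 → (MatA N)ˣ) → Site 4 → ℕ → ℝ → ℝ → ℝ → Prop} (hGm : ∀ F, RadiiMono 4 (G F))
    (hG : ∀ (F : T4Family) (U : Site 4 → Fin 4 → (MatA N)ˣ) (x : Site 4) (K : ℕ) (α₀ α₁ α₂ : ℝ), 2 ≤ K → G F U x K α₀ α₁ α₂ →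
      ∃ (u : Site 4 → (MatA N)ˣ) (a : Site 4 → Fin 4 → MatA N),
        (∀ z, u z ∈ unitaryUnits (MatA N)) ∧
        (∀ (y : Site 4) (τ : Fin 4), l1 (y - x) ≤ 2 → ((gaugeAct u U y τ : (MatA N)ˣ) : MatA N) = exp (a y τ)) ∧
        (∀ (y : Site 4) (τ : Fin 4), l1 (y - x) ≤ 2 → ‖a y τ‖ ≤ α₀) ∧
        (∀ (y : Site 4) (τ i : Fin 4), l1 (y - x) ≤ 1 → ‖fd i (fun z => a z τ) y‖ ≤ α₁) ∧
        (∀ (τ i l : Fin 4), ‖fd i (fd l (fun z => a z τ)) x‖ ≤ α₂))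
    (C : T4Family → B11Thm1.Consts)
    (hR : ∀ (F : T4Family) (k : ℕ) (ε₁ : ℝ), 0 < ε₁ → ε₁ ≤ (C F).a₁ → ∀ (V U : Site 4 → Fin 4 → (MatA N)ˣ), V ∈ sfClass 4 F.L (ne3NperOfRecord₁₁ F 0 0) ε₁ 0 →
      IsMinimiser 4 (sfClass 4 F.L (ne3NperOfRecord₁₁ F 0 0) ((C F).B₃ * ε₁)) F.L (ne3NperOfRecord₁₁ F 0 0) (k + 1) V U →
        ∀ x : Site 4, Regularity (torusVP 4 F.L (ne3NperOfRecord₁₁ F 0 0) (G F) (k + 1)) (C F).B₃ (C F).B₄ ε₁ U (x, F.L ^ (k + 1) - 1 + F.L ^ (k + 1) + 2)) :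
    ∃ (ℓ₃ : T4Family → NE3Letters₁₁) (g B c' : T4Family → ℝ), (∀ F, 0 < g F) ∧ N16LettersEnd N g ℓ₃ ∧
      (∀ F : T4Family, 0 < B F ∧ (ℓ₃ F).ε / B F ≤ (ℓ₃ F).b) ∧
      (∀ F : T4Family, (C F).B₃ ≤ B F ∧ (2 : ℝ) ^ 78 * (F.L : ℝ) ^ 12 ≤ B F) ∧
      (∀ F : T4Family, g F = gradConst 4 (c' F) ∧ (ℓ₃ F).g = gradConst 4 (c' F) ∧ 0 ≤ c' F ∧ (ℓ₃ F).b ≤ c' F ∧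
        (2 : ℝ) ^ 91 * (F.L : ℝ) ^ 17 * c' F ≤ 1 ∧ (2 : ℝ) ^ 76 * (F.L : ℝ) ^ 12 * c' F ≤ (ℓ₃ F).ε ∧
        16 * C0 4 * (ℓ₃ F).ε ≤ 3 ∧ 1024 * (4 + 1) * (4 + 4) * (F.L : ℝ) ^ 2 * (ℓ₃ F).ε ≤ 1 ∧
        (ℓ₃ F).ε / B F ≤ 1 / 4 ∧ 4 * ((ℓ₃ F).ε / B F) ≤ c' F) ∧
      ∀ 𝔯 : RateReading₁₃CoPH N, N16PinnedLoose 𝔯 ℓ₃ B → N16HolderAtReading 𝔯 β := by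
  obtain ⟨ℓ₃, B, c', hEnd, hM, hF, hrows, hH⟩ :=
    exists_letters_n16HolderAtReading_loose_squeezeFull_of_h5_reg910Slot (N := N) hβ0 hβ1 h5 hGm hG C hR
  exact ⟨ℓ₃, fun F => gradConst 4 (c' F), B, c', fun F => gradConst_four_pos (hrows F).2.2.1, hEnd, hM, hF,
    fun F => ⟨rfl, (hrows F).1, (hrows F).2.1, (hrows F).2.2.2.1, (hrows F).2.2.2.2.1, (hrows F).2.2.2.2.2.1, (hrows F).2.2.2.2.2.2.1,
      (hrows F).2.2.2.2.2.2.2.1, (hrows F).2.2.2.2.2.2.2.2.1, (hrows F).2.2.2.2.2.2.2.2.2⟩, hH⟩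

end Producer

/-! ## §5 `hlinkTrim`'s N16-letter block VERBATIM at the pinned carriers (`(c', t) := (c' F, c' F)`) -/

/-- **NODE N19′'s COMPLETE N16-LETTER BLOCK AT THE RATE CARRIERS OF A LOOSE-PINNED READING** — under `N16PinnedLoose 𝔯 ℓ₃ B`, §3's per-family rows become the nine
conjuncts of `…N19RateEdgeHolderD4AtTrimmedLedgerReading` :143–:146 VERBATIM at `(c', t) := (c' F, c' F)`: `R.ne3.g = gradConst 4 (c' F)`, `0 ≤ c' F`, `R.ne3.b ≤ c' F`, `c' F ≤ c' F`,
`2^91·(R.ne3.L)^17·c' ≤ 1`, `2^76·(R.ne3.L)^12·c' ≤ R.ne3.ε`, `16·C0 4·R.ne3.ε ≤ 3`, `1024·(4+1)·(4+4)·(R.ne3.L)²·R.ne3.ε ≤ 1`, `4·((ℓ₃ F).ε ∕ B F) ≤ c' F`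
(module 43 `rateCarriers_ne3_of_pinnedLoose`; necessity of the radii half = dag-n21-w6 p614571). [bookkeeping] -/
theorem n16LetterBlock_rateCarriers_of_pinnedLoose {𝔯 : RateReading₁₃CoPH N} {ℓ₃ : T4Family → NE3Letters₁₁} {B c' : T4Family → ℝ} (hpin : N16PinnedLoose 𝔯 ℓ₃ B)
    (hrows : ∀ F : T4Family, (ℓ₃ F).g = gradConst 4 (c' F) ∧ 0 ≤ c' F ∧ 0 < c' F ∧ (ℓ₃ F).b ≤ c' F ∧
      (2 : ℝ) ^ 91 * (F.L : ℝ) ^ 17 * c' F ≤ 1 ∧ (2 : ℝ) ^ 76 * (F.L : ℝ) ^ 12 * c' F ≤ (ℓ₃ F).ε ∧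
      16 * C0 4 * (ℓ₃ F).ε ≤ 3 ∧ 1024 * (4 + 1) * (4 + 4) * (F.L : ℝ) ^ 2 * (ℓ₃ F).ε ≤ 1 ∧
      (ℓ₃ F).ε / B F ≤ 1 / 4 ∧ 4 * ((ℓ₃ F).ε / B F) ≤ c' F)
    (F : T4Family) (θ : Stage13HParams F N) (hP : θ.Provisos₁₃CoPH F N) (g₀ : ℕ → ℝ) (os : List (ULoop F)) (k : ℕ) :
    (rateCarriersOfRecord₁₃CoPH 𝔯 F θ hP g₀ os k).ne3.g = gradConst 4 (c' F) ∧ 0 ≤ c' F ∧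
      (rateCarriersOfRecord₁₃CoPH 𝔯 F θ hP g₀ os k).ne3.b ≤ c' F ∧ c' F ≤ c' F ∧
      (2 : ℝ) ^ 91 * ((rateCarriersOfRecord₁₃CoPH 𝔯 F θ hP g₀ os k).ne3.L : ℝ) ^ 17 * c' F ≤ 1 ∧
      (2 : ℝ) ^ 76 * ((rateCarriersOfRecord₁₃CoPH 𝔯 F θ hP g₀ os k).ne3.L : ℝ) ^ 12 * c' F ≤ (rateCarriersOfRecord₁₃CoPH 𝔯 F θ hP g₀ os k).ne3.ε ∧
      16 * C0 4 * (rateCarriersOfRecord₁₃CoPH 𝔯 F θ hP g₀ os k).ne3.ε ≤ 3 ∧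
      1024 * (4 + 1) * (4 + 4) * ((rateCarriersOfRecord₁₃CoPH 𝔯 F θ hP g₀ os k).ne3.L : ℝ) ^ 2 * (rateCarriersOfRecord₁₃CoPH 𝔯 F θ hP g₀ os k).ne3.ε ≤ 1 ∧
      4 * ((ℓ₃ F).ε / B F) ≤ c' F := by
  rw [rateCarriers_ne3_of_pinnedLoose hpin F θ hP g₀ os k]
  exact ⟨(hrows F).1, (hrows F).2.1, (hrows F).2.2.2.1, le_rfl, (hrows F).2.2.2.2.1, (hrows F).2.2.2.2.2.1, (hrows F).2.2.2.2.2.2.1,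
    (hrows F).2.2.2.2.2.2.2.1, (hrows F).2.2.2.2.2.2.2.2.2⟩

end

end Summit.QuantumFields.YangMills.BalabanUVNodes.N16PinnedLooseMatchSqueezeClassRadius
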